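import Summits.Ventures.WeilGRH.DualTrigKernelFamily
import HarnessLib

/-!
# Format D-K: the frame check in kernel-sized pieces (proof-only bookkeeping)

Cell `rh-explicit`, WEIL TRACK — GRH ARM, route B (weil-grh-3).  `DKCert.frameOK` is one Boolean; in a
single `decide +kernel` declaration it exceeds the check lane's per-declaration budget as soon as the
claimed phase tables are large (every entry `e^{iπ i/Mc}` is re-checked against `MC.expI`, ≈ 0.1 s of kernel
work each; a fine block with `Mc = 280` alone is ≈ 28 s).  The lemmas below let an instance file prove the
frame in pieces — the table of each block in index ranges of ≤ 150 entries, the cheap shape/constant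
checks, the tail — and assemble `frameOK` / `check`.  No new definitions (the pieces are stated with the
checker's own sub-expressions), so instances cite them verbatim.  Elementary; no named facts, no `sorry`.
-/

namespace Summit.Ventures.WeilGRH

open Literature.Analysis.ValidatedNumerics.NumericsMP

namespace DKCert

variable {c : DKCert}

/-- `all` over `range (m + n)` splits into the first `m` and the next `n` indices. [folklore] -/
theorem all_range_add (f : ℕ → Bool) (m n : ℕ) :
    (List.range (m + n)).all f = ((List.range m).all f && (List.range n).all fun i => f (m + i)) := by
  rw [List.range_add, List.all_append, List.all_map]
  rfl

/-- The phase-table check of a block from TWO index ranges `[0, m)` and `[m, m + n)`, `m + n = Mc`. [folklore] -/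
theorem tabOK_of_two (c : DKCert) (b : DKBlock) (m n : ℕ) (hmn : m + n = b.Mc)
    (h1 : ((List.range m).all fun i =>
      match MC.expI c.S c.Kser c.kexp c.piI ((c.piI.mulInt i).divNat b.Mc) with
      | some Z => encl (tabEntry b i).re Z.re && encl (tabEntry b i).im Z.im
      | none => false) = true)
    (h2 : ((List.range n).all fun i =>
      match MC.expI c.S c.Kser c.kexp c.piI ((c.piI.mulInt ((m + i : ℕ) : ℤ)).divNat b.Mc) with
      | some Z => encl (tabEntry b (m + i)).re Z.re && encl (tabEntry b (m + i)).im Z.im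
      | none => false) = true) :
    c.tabOK b = true := by
  unfold tabOK
  have e : List.range b.Mc = List.range (m + n) := by rw [hmn]
  rw [e, all_range_add, Bool.and_eq_true]
  exact ⟨h1, h2⟩

/-- The phase-table check of a block from THREE index ranges. [folklore] -/
theorem tabOK_of_three (c : DKCert) (b : DKBlock) (m n k : ℕ) (hmn : m + n + k = b.Mc)
    (h1 : ((List.range m).all fun i =>
      match MC.expI c.S c.Kser c.kexp c.piI ((c.piI.mulInt i).divNat b.Mc) with
      | some Z => encl (tabEntry b i).re Z.re && encl (tabEntry b i).im Z.im
      | none => false) = true)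
    (h2 : ((List.range n).all fun i =>
      match MC.expI c.S c.Kser c.kexp c.piI ((c.piI.mulInt ((m + i : ℕ) : ℤ)).divNat b.Mc) with
      | some Z => encl (tabEntry b (m + i)).re Z.re && encl (tabEntry b (m + i)).im Z.im
      | none => false) = true)
    (h3 : ((List.range k).all fun i =>
      match MC.expI c.S c.Kser c.kexp c.piI ((c.piI.mulInt ((m + n + i : ℕ) : ℤ)).divNat b.Mc) with
      | some Z => encl (tabEntry b (m + n + i)).re Z.re && encl (tabEntry b (m + n + i)).im Z.im
      | none => false) = true) :
    c.tabOK b = true := by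
  unfold tabOK
  have e : List.range b.Mc = List.range (m + n + k) := by rw [hmn]
  rw [e, all_range_add, all_range_add, Bool.and_eq_true, Bool.and_eq_true]
  exact ⟨⟨h1, h2⟩, h3⟩

/-- The phase-table check of a block from FOUR index ranges. [folklore] -/
theorem tabOK_of_four (c : DKCert) (b : DKBlock) (m n k l : ℕ) (hmn : m + n + k + l = b.Mc)
    (h1 : ((List.range m).all fun i =>
      match MC.expI c.S c.Kser c.kexp c.piI ((c.piI.mulInt i).divNat b.Mc) with
      | some Z => encl (tabEntry b i).re Z.re && encl (tabEntry b i).im Z.im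
      | none => false) = true)
    (h2 : ((List.range n).all fun i =>
      match MC.expI c.S c.Kser c.kexp c.piI ((c.piI.mulInt ((m + i : ℕ) : ℤ)).divNat b.Mc) with
      | some Z => encl (tabEntry b (m + i)).re Z.re && encl (tabEntry b (m + i)).im Z.im
      | none => false) = true)
    (h3 : ((List.range k).all fun i =>
      match MC.expI c.S c.Kser c.kexp c.piI ((c.piI.mulInt ((m + n + i : ℕ) : ℤ)).divNat b.Mc) with
      | some Z => encl (tabEntry b (m + n + i)).re Z.re && encl (tabEntry b (m + n + i)).im Z.im
      | none => false) = true)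
    (h4 : ((List.range l).all fun i =>
      match MC.expI c.S c.Kser c.kexp c.piI ((c.piI.mulInt ((m + n + k + i : ℕ) : ℤ)).divNat b.Mc) with
      | some Z => encl (tabEntry b (m + n + k + i)).re Z.re && encl (tabEntry b (m + n + k + i)).im Z.im
      | none => false) = true) :
    c.tabOK b = true := by
  unfold tabOK
  have e : List.range b.Mc = List.range (m + n + k + l) := by rw [hmn]
  rw [e, all_range_add, all_range_add, all_range_add, Bool.and_eq_true, Bool.and_eq_true, Bool.and_eq_true]
  exact ⟨⟨⟨h1, h2⟩, h3⟩, h4⟩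

/-- `blocksOK` from the block SHAPE checks (stated without the tables) and the per-block table checks.
[folklore] -/
theorem blocksOK_of_shape_of_tabs
    (hs : ((c.blocks.all fun b => decide (1 ≤ b.Mc) && decide (1 ≤ b.n) && decide (1 ≤ b.nin) &&
        decide (1 ≤ b.etaDen) && decide (c.piI.hi * (b.etaDen : ℤ) ≤ (b.etaNum : ℤ) * c.S * b.Mc)) &&
      ((c.blocks.zip c.blocks.tail).all fun p =>
        decide (p.2.j0 * (p.1.Mc : ℤ) ≤ (p.1.j0 + p.1.n) * (p.2.Mc : ℤ))) &&
      (match c.blocks.head?, c.blocks.getLast? with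
        | some b0, some bl =>
          (if c.even then decide (b0.j0 ≤ 0) else decide (2 * b0.j0 ≤ -(b0.Mc : ℤ))) &&
          decide ((bl.Mc : ℤ) ≤ 2 * (bl.j0 + bl.n))
        | _, _ => false)) = true)
    (ht : ∀ b ∈ c.blocks, c.tabOK b = true) : c.blocksOK = true := by
  unfold blocksOK
  simp only [Bool.and_eq_true, List.all_eq_true, decide_eq_true_eq] at hs ⊢
  obtain ⟨⟨hall, hchain⟩, hends⟩ := hs
  refine ⟨⟨fun b hb ↦ ?_, hchain⟩, hends⟩
  obtain ⟨⟨⟨⟨h1, h2⟩, h3⟩, h4⟩, h5⟩ := hall b hb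
  exact ⟨⟨⟨⟨⟨h1, h2⟩, h3⟩, h4⟩, h5⟩, ht b hb⟩

/-- `frameOK` from its parts: constants/window/atoms, block shape + tables (as `blocksOK`), tail. [folklore] -/
theorem frameOK_of_parts (h1 : (c.constsOK && c.valsOK && c.valsNodup && c.atomsOK) = true)
    (hb : c.blocksOK = true) (htail : c.tailOK = true) : c.frameOK = true := by
  simp only [Bool.and_eq_true] at h1
  obtain ⟨⟨⟨ha, hv⟩, hn⟩, hat⟩ := h1
  unfold frameOK
  simp only [Bool.and_eq_true]
  exact ⟨⟨⟨⟨⟨ha, hv⟩, hn⟩, hb⟩, hat⟩, htail⟩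

/-- `check` from `frameOK` and `cellsOK`. [folklore] -/
theorem check_of_parts (hf : c.frameOK = true) (hc : c.cellsOK = true) : c.check = true := by
  unfold check; rw [hf, hc]; rfl

end DKCert

end Summit.Ventures.WeilGRH
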